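import Literature.Algebra.Homology.StaircasePresentation
import Literature.Algebra.Homology.StaircaseTorsionFree
import HarnessLib

/-!
# Scaled comparison maps between staircase image subcomplexes: multiplication by `q^g`

Continuation of `Algebra/Homology/StaircaseComplexes` / `…Presentation`. For an abelian category
`𝒜`, a complex `K : CochainComplex 𝒜 ℕ`, `q : ℤ`, antitone exponent functions `e`, `e'` and a
global exponent `g : ℕ` with `e' ≤ e + g` (pointwise), MULTIPLICATION BY `q^g` maps the staircase
image subcomplex `q^{e}K` into `q^{e'}K`:

* `powImageMulLE K q he he' g hle : powImage K q he ⟶ powImage K q he'` — degreewise the map on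
  images induced by the square `q^{e j} ≫ (q^g • 𝟙) = (q^{e j + g - e' j} • 𝟙) ≫ q^{e' j}`
  (Mathlib's `image.map`), a chain map; over the inclusions it is `q^g • 𝟙 K`
  (`powImageMulLE_comp_powImageι`); for `g = 0` it is the inclusion `powImageLE`
  (`powImageMulLE_zero`);
* `powImageMulLE_comp_powImageLE`: followed by an inclusion `q^{e'}K ⊆ q^{e''}K` it is
  `q^g •` (the inclusion `q^{e}K ⊆ q^{e''}K`) whenever `e'' ≤ e` — the identity
  "`(× q^g) ≫ incl = q^g • incl`" used to DIVIDE inclusions of staircases by powers of `q`;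
* `isIso_powImageMulLE_f`: in a degree `j` where `e j + g = e' j` EXACTLY and `Kʲ` has no
  `q`-torsion (`q • 𝟙 Kʲ` mono), the component `(q^{e j}Kʲ → q^{e' j}Kʲ)` is an ISOMORPHISM
  (`q^{e j} y ↦ q^{e j + g} y`).

Use (`AlgebraicGeometry/Crystalline`, X. Hu's complexes, arXiv:2507.12458 §8 / Bloch–Esnault–Kerz
arXiv:1203.2776 §2): with `e = (r-•)N ∸ (N-M)`, `e' = (r-•)N`, `g = N - M` the map is an
isomorphism in degrees `≤ r - 1`, and the inclusion `q^{(r-•)N}Ω• ⊆ q^{(r-•)M}Ω•` becomes, on the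
truncations `σ≤(r-1)`, `q^{N-M}` times a chain map — the divisibility of the images of
`ℍ(σ≤(r-1) q^{(r-•)N}Ω•)` in `ℍ(σ≤(r-1) q^{(r-•)M}Ω•)` by `q^{N-M}` behind the torsion-freeness of
`lim_N ℍ^{2r}(p^{r,1}_{r,N}Ω•)`. [folklore] Everything is proved; no named facts.
-/

noncomputable section

namespace Literature.Algebra.Homology

open CategoryTheory CategoryTheory.Limits

universe v u

variable {𝒜 : Type u} [Category.{v} 𝒜] [Abelian 𝒜]

section MulLE

variable (K : CochainComplex 𝒜 ℕ) (q : ℤ) {e e' : ℕ → ℕ} (he : Antitone e) (he' : Antitone e')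
  (g : ℕ) (hle : ∀ j, e' j ≤ e j + g)

/-- The square `q^{e j} ≫ (q^g • 𝟙) = (q^{e j + g - e' j} • 𝟙) ≫ q^{e' j}` on `Kʲ`, as a morphism of
arrows (for `e' j ≤ e j + g`). [folklore] -/
def powMulArrowHom (j : ℕ) : Arrow.mk (powSMul K q e j) ⟶ Arrow.mk (powSMul K q e' j) :=
  Arrow.homMk' (((q ^ (e j + g - e' j)) : ℤ) • 𝟙 (K.X j)) (((q ^ g) : ℤ) • 𝟙 (K.X j)) (by
    change ((q ^ (e j + g - e' j) : ℤ) • 𝟙 (K.X j)) ≫ ((q ^ e' j : ℤ) • 𝟙 (K.X j)) =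
      ((q ^ e j : ℤ) • 𝟙 (K.X j)) ≫ ((q ^ g : ℤ) • 𝟙 (K.X j))
    rw [pow_smul_id_comp_pow_smul_id, pow_smul_id_comp_pow_smul_id, Nat.sub_add_cancel (hle j)])

/-- The components of multiplication by `q^g` from `q^{e j}Kʲ` to `q^{e' j}Kʲ` (map on images induced
by `powMulArrowHom`). [folklore] -/
def powImageMulLEf (j : ℕ) : image (powSMul K q e j) ⟶ image (powSMul K q e' j) :=
  image.map (powMulArrowHom K q g hle j)

/-- `(× q^g)ʲ ≫ ι = ι ≫ (q^g • 𝟙)` degreewise. [folklore] -/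
@[reassoc (attr := simp)]
theorem powImageMulLEf_ι (j : ℕ) :
    powImageMulLEf K q g hle j ≫ image.ι (powSMul K q e' j) =
      image.ι (powSMul K q e j) ≫ (((q ^ g) : ℤ) • 𝟙 (K.X j)) :=
  image.map_homMk'_ι _

/-- **Multiplication by `q^g` from `q^{e}K` into `q^{e'}K`** (`e' ≤ e + g`), a chain map of
staircase image subcomplexes. [folklore] -/
def powImageMulLE : powImage K q he ⟶ powImage K q he' where
  f j := powImageMulLEf K q g hle j
  comm' i j hij := by
    change i + 1 = j at hij
    subst hij
    rw [powImage_d, powImage_d, ← cancel_mono (image.ι (powSMul K q e' (i + 1))), Category.assoc,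
      Category.assoc, powImageD_ι, powImageMulLEf_ι, powImageD_ι_assoc, powImageMulLEf_ι_assoc]
    simp only [Preadditive.zsmul_comp, Preadditive.comp_zsmul, Category.id_comp, Category.comp_id]

/-- The components of `powImageMulLE`. [folklore] -/
@[simp] theorem powImageMulLE_f (j : ℕ) :
    (powImageMulLE K q he he' g hle).f j = powImageMulLEf K q g hle j := rfl

/-- The inclusion `q^{e}K ⟶ K` is a monomorphism of complexes. [folklore] -/
instance mono_powImageι : Mono (powImageι K q he) :=
  HomologicalComplex.mono_of_mono_f _ fun j ↦ mono_powImageι_f K q he j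

/-- **`(× q^g) ≫ ι = ι ≫ (q^g • 𝟙 K)`**: over the inclusions into `K`, `powImageMulLE` is
multiplication by `q^g`. [folklore] -/
@[reassoc]
theorem powImageMulLE_comp_powImageι :
    powImageMulLE K q he he' g hle ≫ powImageι K q he' =
      powImageι K q he ≫ (((q ^ g) : ℤ) • 𝟙 K) := by
  refine HomologicalComplex.hom_ext _ _ fun j ↦ ?_
  rw [HomologicalComplex.comp_f, HomologicalComplex.comp_f, powImageMulLE_f, powImageι_f,
    powImageι_f, powImageMulLEf_ι, HomologicalComplex.zsmul_f_apply, HomologicalComplex.id_f]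

/-- **`(× q^g) ≫ (q^{e'}K ⊆ q^{e''}K) = q^g • (q^{e}K ⊆ q^{e''}K)`** for `e'' ≤ e'` and `e'' ≤ e`:
multiplication by `q^g` followed by an inclusion is `q^g` times an inclusion — the identity by
which inclusions of staircases are divided by powers of `q`. [folklore] -/
theorem powImageMulLE_comp_powImageLE {e'' : ℕ → ℕ} (he'' : Antitone e'') (h' : e'' ≤ e')
    (h : e'' ≤ e) :
    powImageMulLE K q he he' g hle ≫ powImageLE K q he'' he' h' =
      ((q ^ g) : ℤ) • powImageLE K q he'' he h := by
  rw [← cancel_mono (powImageι K q he''), Category.assoc, powImageLE_comp_powImageι,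
    powImageMulLE_comp_powImageι, Preadditive.zsmul_comp, powImageLE_comp_powImageι,
    Preadditive.comp_zsmul, Category.comp_id]

/-- For `g = 0` (so `e' ≤ e`), `powImageMulLE` is the inclusion `q^{e}K ⊆ q^{e'}K`. [folklore] -/
theorem powImageMulLE_zero (hle₀ : ∀ j, e' j ≤ e j + 0) :
    powImageMulLE K q he he' 0 hle₀ = powImageLE K q he' he fun j ↦ by simpa using hle₀ j := by
  rw [← cancel_mono (powImageι K q he'), powImageMulLE_comp_powImageι, powImageLE_comp_powImageι,
    pow_zero, one_smul, Category.comp_id]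

/-- **Degreewise isomorphism**: in a degree `j` with `e j + g = e' j` exactly and `Kʲ` without
`q`-torsion, multiplication by `q^g` is an isomorphism `q^{e j}Kʲ ⥲ q^{e' j}Kʲ` (mono because
`ι ≫ q^g` is, epi because `q^{e' j} y = q^g (q^{e j} y)`). [folklore] -/
theorem isIso_powImageMulLE_f (j : ℕ) [Mono ((q : ℤ) • 𝟙 (K.X j))] (hj : e j + g = e' j) :
    IsIso ((powImageMulLE K q he he' g hle).f j) := by
  haveI hmono : Mono ((powImageMulLE K q he he' g hle).f j) := by
    haveI : Mono (((q ^ g) : ℤ) • 𝟙 (K.X j)) := mono_pow_smul_id q g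
    haveI : Mono (image.ι (powSMul K q e j) ≫ (((q ^ g) : ℤ) • 𝟙 (K.X j))) := mono_comp _ _
    exact mono_of_mono_fac (powImageMulLEf_ι K q g hle j)
  haveI hepi : Epi ((powImageMulLE K q he he' g hle).f j) := by
    have hfac : factorThruImage (powSMul K q e j) ≫ (powImageMulLE K q he he' g hle).f j =
        factorThruImage (powSMul K q e' j) := by
      rw [← cancel_mono (image.ι (powSMul K q e' j)), Category.assoc, powImageMulLE_f,
        powImageMulLEf_ι, image.fac_assoc, image.fac]
      change ((q ^ e j : ℤ) • 𝟙 (K.X j)) ≫ ((q ^ g : ℤ) • 𝟙 (K.X j)) = (q ^ e' j : ℤ) • 𝟙 (K.X j)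
      rw [pow_smul_id_comp_pow_smul_id, hj]
    exact epi_of_epi_fac hfac
  exact isIso_of_mono_of_epi _

end MulLE

end Literature.Algebra.Homology

end
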